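import Summits.AtomisticToContinuum.BoseEinsteinCondensation.Theorems.BECThomsonPrincipleFibreFubini
import Literature.MathematicalPhysics.QuantumManyBody.PeriodicBoseGasLemma33
import HarnessLib

/-!
# Route `BECThomsonPrinciple`, crux `FibreConductance` (stmt-AtomisticToContinuum-9480),
# line `parseval-shell-bootstrap` — stub `stub_parsevalShell`, part I: the occupation-sum identity
# and the lattice count

Deterministic Fourier bookkeeping for the Parseval side of the line (consumed by the registered
stub `stub_parsevalShell : ShellOccupation → FlatBound` in
`BECThomsonPrincipleFibreConductanceStubParsevalShell`). The bath-averaged FLAT corrector energy of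
the gradient charge `ε♭ = L^{-3/2}[e^{ik·x₀}(k·∇₀ψ)/(i|k|²) + β/L³]` (`gradDefect`, `flatEnergy` of
`BECThomsonPrincipleDefs`) is a pure occupation sum:

* fibre Fourier coefficients (`ps_cellFourierCoeff_gradDefect`): for `p ≠ 0`,
  `ĉ_p(ε♭(·,X̂)) = L^{-3/2} (n·(p−n)/|n|²) ĉ_{p−n}(ψ(·|X̂))` — the constant `β/L³` has no non-zero
  modes, multiplication by `e^{ik·y} = e_n` shifts the index by `n`, and the derivative rule
  `ĉ_q(∂_l f) = (2πi q_l/L) ĉ_q(f)` (`cellFourierCoeff_fderiv`) applies to the `C¹` periodic slice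
  `y ↦ ψ(X[0↦y])` (chain rule `∂_l(ψ ∘ X[0↦·]) = dPsi`);
* bath average (`ps_lintegral_fibreW_mul_flatEnergy_eq`): with
  `∫ W |ĉ_q(ψ(·|X̂))|² dX = n_q(|Φ|)/N` (`lintegral_fibreW_mul_norm_sq_cellFourierCoeff`) and Tonelli,
  `∫_{cell^N} W·flatEnergy = Σ_{p≠0} w_p n_{p−n}(|Φ|)/N`, `w_p = (n·(p−n))²/(|n|⁴|k_p|²)`;
* the lattice count `Σ_{p ∈ ℤ³, 0<‖p‖_∞≤R} ‖p‖_∞⁻² ≤ 26R` (`ps_lattice_count`, shell by shell), which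
  pays for the resonant shell in part II.

Registered anchor (`--supports` the crux item): `ps_lattice_count`.

References: the line card `Cruxes/FibreConductance/Lines/parseval-shell-bootstrap.md`; LSSY2005
§1.2 (1.17) (occupations) — used only as the meaning of `cellOccupation`.
-/

noncomputable section

namespace Summit.AtomisticToContinuum.BoseEinsteinCondensation.Cruxes.FibreConductance.ParsevalShellBootstrap

open MeasureTheory
open scoped ENNReal ComplexConjugate
open Literature.MathematicalPhysics.QuantumManyBody.BoseGas

variable {m : ℕ} {L : ℝ}

/-! ### Linearity and index shift of the cell Fourier coefficients -/

/-- Multiplication by the plane wave `e_n` shifts the Fourier index: `ĉ_q(e_n f) = ĉ_{q−n}(f)`.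
[folklore] -/
theorem ps_cellFourierCoeff_cellWave_mul (hL : 0 < L) (n q : Fin 3 → ℤ) (f : Space → ℂ) :
    cellFourierCoeff L (fun y => cellWave L n y * f y) q = cellFourierCoeff L f (q - n) := by
  rw [cellFourierCoeff_eq_integral hL, cellFourierCoeff_eq_integral hL]
  congr 1
  refine setIntegral_congr_fun (measurableSet_cell L) fun y _ => ?_
  rw [← mul_assoc, conj_cellWave, conj_cellWave, ← cellWave_add_index, neg_sub, ← neg_add_eq_sub]

/-- A constant has no non-zero Fourier modes on the cell. [folklore] -/
theorem ps_cellFourierCoeff_const (hL : 0 < L) (c : ℂ) {q : Fin 3 → ℤ} (hq : q ≠ 0) :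
    cellFourierCoeff L (fun _ => c) q = 0 := by
  rw [cellFourierCoeff_eq_integral hL]
  simp_rw [conj_cellWave]
  rw [integral_mul_const, integral_cell_cellWave_eq_zero hL (neg_ne_zero.2 hq), zero_mul,
    smul_zero]

/-- Additivity of the Fourier coefficients of continuous functions. [folklore] -/
theorem ps_cellFourierCoeff_add (hL : 0 < L) {f g : Space → ℂ} (hf : Continuous f)
    (hg : Continuous g) (q : Fin 3 → ℤ) :
    cellFourierCoeff L (fun y => f y + g y) q = cellFourierCoeff L f q + cellFourierCoeff L g q := by
  simp only [cellFourierCoeff_eq_integral hL]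
  have hcw : Continuous fun y : Space => conj (cellWave L q y) :=
    Complex.continuous_conj.comp (contDiff_cellWave L q).continuous
  have hf' : Continuous fun y : Space => conj (cellWave L q y) * f y := hcw.mul hf
  have hg' : Continuous fun y : Space => conj (cellWave L q y) * g y := hcw.mul hg
  rw [← smul_add, ← integral_add (integrableOn_cell hf') (integrableOn_cell hg')]
  simp_rw [mul_add]

/-- Finite additivity of the Fourier coefficients of continuous functions. [folklore] -/
theorem ps_cellFourierCoeff_sum (hL : 0 < L) {ι : Type*} (s : Finset ι) {f : ι → Space → ℂ}
    (hf : ∀ i, Continuous (f i)) (q : Fin 3 → ℤ) :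
    cellFourierCoeff L (fun y => ∑ i ∈ s, f i y) q = ∑ i ∈ s, cellFourierCoeff L (f i) q := by
  simp only [cellFourierCoeff_eq_integral hL]
  have hcw : Continuous fun y : Space => conj (cellWave L q y) :=
    Complex.continuous_conj.comp (contDiff_cellWave L q).continuous
  have hf' : ∀ i, Continuous fun y : Space => conj (cellWave L q y) * f i y := fun i =>
    hcw.mul (hf i)
  rw [← Finset.smul_sum, ← integral_finsetSum s (fun i _ => integrableOn_cell (hf' i))]
  simp_rw [Finset.mul_sum]

/-! ### The fibre slice `y ↦ ψ(X[0↦y])` of the conditional amplitude -/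

/-- The (complexified) slice `y ↦ ψ(X[0↦y])` is `C¹`. [folklore] -/
theorem ps_contDiff_slice (hL : 0 < L) (Φ : PeriodicTrialState (m + 1) L) (hΦ : ∀ X, Φ.ψ X ≠ 0)
    (X : Config (m + 1)) :
    ContDiff ℝ 1 fun y : Space => (fibrePsi Φ (Function.update X 0 y) : ℂ) :=
  Complex.ofRealCLM.contDiff.comp ((contDiff_fibrePsi hL Φ hΦ).comp (contDiff_update 1 X 0))

/-- The slice is `Lℤ³`-periodic. [folklore] -/
theorem ps_slice_periodic (Φ : PeriodicTrialState (m + 1) L) (X : Config (m + 1)) (y : Space)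
    (k : Fin 3) :
    (fibrePsi Φ (Function.update X 0 (y + EuclideanSpace.single k L)) : ℂ) =
      fibrePsi Φ (Function.update X 0 y) := by
  rw [update_zero_add, fibrePsi_periodic]

/-- Chain rule in the fibre: `∂_l` of the slice at `y` is `dPsi Φ (X[0↦y]) l`. [folklore] -/
theorem ps_fderiv_slice (hL : 0 < L) (Φ : PeriodicTrialState (m + 1) L) (hΦ : ∀ X, Φ.ψ X ≠ 0)
    (X : Config (m + 1)) (y : Space) (l : Fin 3) :
    fderiv ℝ (fun y : Space => (fibrePsi Φ (Function.update X 0 y) : ℂ)) y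
        (EuclideanSpace.single l 1) =
      (dPsi Φ (Function.update X 0 y) l : ℂ) := by
  have h1 : HasFDerivAt (fun y : Space => fibrePsi Φ (Function.update X 0 y))
      ((fderiv ℝ (fibrePsi Φ) (Function.update X 0 y)).comp
        (ContinuousLinearMap.pi (Pi.single 0 (ContinuousLinearMap.id ℝ Space)))) y :=
    (((contDiff_fibrePsi hL Φ hΦ).differentiable one_ne_zero) _).hasFDerivAt.comp y
      (hasFDerivAt_update X y)
  have h2 := (Complex.ofRealCLM.hasFDerivAt.comp y h1).fderiv
  rw [show (fun y : Space => (fibrePsi Φ (Function.update X 0 y) : ℂ)) =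
      Complex.ofRealCLM ∘ (fun y : Space => fibrePsi Φ (Function.update X 0 y)) from rfl, h2,
    ContinuousLinearMap.comp_apply, ContinuousLinearMap.comp_apply, pi_single_id_apply]
  rfl

/-- The gradient term of the charge along the slice, `Σ_l k_l ∂_lψ`, is continuous in `y`.
[folklore] -/
theorem ps_continuous_kgrad (hL : 0 < L) (n : Fin 3 → ℤ) (Φ : PeriodicTrialState (m + 1) L)
    (hΦ : ∀ X, Φ.ψ X ≠ 0) (X : Config (m + 1)) :
    Continuous fun y : Space =>
      ((∑ l : Fin 3, 2 * Real.pi * (n l : ℝ) / L * dPsi Φ (Function.update X 0 y) l : ℝ) : ℂ) := by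
  refine Complex.continuous_ofReal.comp (continuous_finsetSum _ fun l _ => ?_)
  exact continuous_const.mul ((continuous_dPsi hL Φ hΦ l).comp (continuous_const.update 0 continuous_id))

/-! ### Fibre Fourier coefficients of the gradient charge -/

/-- **Fibre Fourier coefficients of the gradient charge**: for `p ≠ 0`,
`ĉ_p(ε♭(·,X̂)) = (√L³)⁻¹ (n·(p−n)/|n|²) ĉ_{p−n}(ψ(·|X̂))` (`= L^{-3/2}(k·k_{p−n}/|k|²) ĉ_{p−n}(ψ)`):
the constant `β/L³` drops, `e_n` shifts the index, the derivative rule turns `k·∇ψ` into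
`i k·k_{p−n} ĉ_{p−n}(ψ)` and the `i`'s cancel. [folklore] -/
theorem ps_cellFourierCoeff_gradDefect (hL : 0 < L) {n : Fin 3 → ℤ} (hn : n ≠ 0)
    (Φ : PeriodicTrialState (m + 1) L) (hΦ : ∀ X, Φ.ψ X ≠ 0) (X : Config (m + 1))
    {p : Fin 3 → ℤ} (hp : p ≠ 0) :
    cellFourierCoeff L (fun y => gradDefect n Φ (Function.update X 0 y)) p =
      (((Real.sqrt (L ^ 3))⁻¹ *
          ((∑ l : Fin 3, (n l : ℝ) * ((p l : ℝ) - n l)) / ∑ l : Fin 3, (n l : ℝ) ^ 2) : ℝ) : ℂ) *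
        cellFourierCoeff L (fun y => (fibrePsi Φ (Function.update X 0 y) : ℂ)) (p - n) := by
  -- notation: the slice `φ` and the gradient term `S = Σ_l k_l ∂_lψ` along the slice
  set φ : Space → ℂ := fun y => (fibrePsi Φ (Function.update X 0 y) : ℂ) with hφ
  set S : Space → ℂ := fun y =>
    ((∑ l : Fin 3, 2 * Real.pi * (n l : ℝ) / L * dPsi Φ (Function.update X 0 y) l : ℝ) : ℂ) with hS
  have hSc : Continuous S := ps_continuous_kgrad hL n Φ hΦ X
  -- the slice of the charge
  have hg : (fun y => gradDefect n Φ (Function.update X 0 y)) =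
      fun y => ((Real.sqrt (L ^ 3))⁻¹ : ℂ) *
        (cellWave L n y * ((Complex.I * (ksq L n : ℂ))⁻¹ * S y) + fibreBeta n Φ X / ((L : ℂ) ^ 3)) := by
    funext y
    simp only [gradDefect, Function.update_self, fibreBeta_update, phase_eq_cellWave, hS,
      div_eq_mul_inv]
    ring
  -- step 1: constants out, index shift, the constant term drops
  have h1 : cellFourierCoeff L (fun y => gradDefect n Φ (Function.update X 0 y)) p =
      ((Real.sqrt (L ^ 3))⁻¹ : ℂ) * ((Complex.I * (ksq L n : ℂ))⁻¹ * cellFourierCoeff L S (p - n)) := by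
    rw [hg, cellFourierCoeff_const_mul hL]
    congr 1
    have hA : Continuous fun y : Space => cellWave L n y * ((Complex.I * (ksq L n : ℂ))⁻¹ * S y) :=
      (contDiff_cellWave L n).continuous.mul (continuous_const.mul hSc)
    rw [ps_cellFourierCoeff_add hL hA continuous_const, ps_cellFourierCoeff_const hL _ hp, add_zero,
      ps_cellFourierCoeff_cellWave_mul hL, cellFourierCoeff_const_mul hL]
  -- step 2: the derivative rule on each component of `k·∇ψ`
  have hper : ∀ (x : Space) (k : Fin 3), φ (x + EuclideanSpace.single k L) = φ x :=
    fun x k => ps_slice_periodic Φ X x k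
  have h2 : cellFourierCoeff L S (p - n) =
      ∑ l : Fin 3, ((2 * Real.pi * (n l : ℝ) / L : ℝ) : ℂ) *
        ((2 * Real.pi * Complex.I * ((p - n) l) / L) * cellFourierCoeff L φ (p - n)) := by
    have hSsum : S = fun y => ∑ l : Fin 3, ((2 * Real.pi * (n l : ℝ) / L : ℝ) : ℂ) *
        fderiv ℝ φ y (EuclideanSpace.single l 1) := by
      funext y
      simp only [hS, hφ, ps_fderiv_slice hL Φ hΦ X, Complex.ofReal_sum, Complex.ofReal_mul]
    have hcomp : ∀ l : Fin 3, Continuous fun y : Space =>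
        ((2 * Real.pi * (n l : ℝ) / L : ℝ) : ℂ) * fderiv ℝ φ y (EuclideanSpace.single l 1) :=
      fun l => continuous_const.mul
        (((ps_contDiff_slice hL Φ hΦ X).continuous_fderiv one_ne_zero).clm_apply continuous_const)
    rw [hSsum, ps_cellFourierCoeff_sum hL _ hcomp]
    refine Finset.sum_congr rfl fun l _ => ?_
    rw [cellFourierCoeff_const_mul hL, cellFourierCoeff_fderiv hL (ps_contDiff_slice hL Φ hΦ X) hper]
  -- step 3: `Σ_l k_l (i k'_l) ĉ = i (2π/L)² (n·(p-n)) ĉ`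
  have hT : ∑ l : Fin 3, ((2 * Real.pi * (n l : ℝ) / L : ℝ) : ℂ) *
        ((2 * Real.pi * Complex.I * ((p - n) l) / L) * cellFourierCoeff L φ (p - n)) =
      Complex.I * (((2 * Real.pi / L) ^ 2 * ∑ l : Fin 3, (n l : ℝ) * ((p l : ℝ) - n l) : ℝ) : ℂ) *
        cellFourierCoeff L φ (p - n) := by
    simp_rw [← mul_assoc]
    rw [← Finset.sum_mul]
    congr 1
    push_cast
    rw [Finset.mul_sum, Finset.mul_sum]
    refine Finset.sum_congr rfl fun l _ => ?_
    simp only [Pi.sub_apply, Int.cast_sub]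
    ring
  -- step 4: the scalar algebra `(√L³)⁻¹ (i|k|²)⁻¹ i (2π/L)² (n·(p-n)) = (√L³)⁻¹ (n·(p-n))/|n|²`
  have hν : (∑ l : Fin 3, (n l : ℝ) ^ 2) ≠ 0 := by
    obtain ⟨j, hj⟩ := Function.ne_iff.mp hn
    have hj' : (0 : ℝ) < (n j : ℝ) ^ 2 := sq_pos_iff.mpr (by exact_mod_cast hj)
    exact (lt_of_lt_of_le hj' (Finset.single_le_sum (f := fun l => (n l : ℝ) ^ 2)
      (fun l _ => sq_nonneg _) (Finset.mem_univ j))).ne'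
  have hLc : (L : ℂ) ≠ 0 := Complex.ofReal_ne_zero.2 hL.ne'
  have hπ : (Real.pi : ℂ) ≠ 0 := Complex.ofReal_ne_zero.2 Real.pi_ne_zero
  have hI : Complex.I ≠ 0 := Complex.I_ne_zero
  have hsq : (Real.sqrt (L ^ 3) : ℂ) ≠ 0 :=
    Complex.ofReal_ne_zero.2 (Real.sqrt_pos.2 (by positivity)).ne'
  have hνc : ((∑ l : Fin 3, (n l : ℝ) ^ 2 : ℝ) : ℂ) ≠ 0 := Complex.ofReal_ne_zero.2 hν
  push_cast at hνc
  rw [h1, h2, hT]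
  simp only [ksq]
  push_cast
  field_simp

/-! ### The bath average of the flat corrector energy -/

/-- Pointwise on the bath: `W·flatEnergy = Σ'_{p ≠ 0} w_p · (W |ĉ_{p−n}(ψ(·|X̂))|²)` with the weight
`w_p = (n·(p−n))²/(|n|⁴ |k_p|²)`. [folklore] -/
theorem ps_fibreW_mul_flatEnergy (hL : 0 < L) {n : Fin 3 → ℤ} (hn : n ≠ 0)
    (Φ : PeriodicTrialState (m + 1) L) (hΦ : ∀ X, Φ.ψ X ≠ 0) (X : Config (m + 1)) :
    ENNReal.ofReal (fibreW Φ X) * flatEnergy n Φ X =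
      ∑' p : Fin 3 → ℤ, if p = 0 then 0 else
        ENNReal.ofReal ((∑ l, (n l : ℝ) * ((p l : ℝ) - n l)) ^ 2 /
            ((∑ l, (n l : ℝ) ^ 2) ^ 2 * ((2 * Real.pi / L) ^ 2 * ∑ j, (p j : ℝ) ^ 2))) *
          ENNReal.ofReal (fibreW Φ X *
            ‖cellFourierCoeff L (fun y => (fibrePsi Φ (Function.update X 0 y) : ℂ)) (p - n)‖ ^ 2) := by
  rw [flatEnergy, ← mul_assoc, ← ENNReal.tsum_mul_left]
  refine tsum_congr fun p => ?_
  split_ifs with hp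
  · rw [mul_zero]
  · have hw : (0 : ℝ) ≤ (∑ l, (n l : ℝ) * ((p l : ℝ) - n l)) ^ 2 /
        ((∑ l, (n l : ℝ) ^ 2) ^ 2 * ((2 * Real.pi / L) ^ 2 * ∑ j, (p j : ℝ) ^ 2)) := by positivity
    rw [ps_cellFourierCoeff_gradDefect hL hn Φ hΦ X hp, norm_mul, Complex.norm_real,
      Real.norm_eq_abs, mul_pow, sq_abs, ← ENNReal.ofReal_mul (fibreW_nonneg Φ X),
      ← ENNReal.ofReal_mul (mul_nonneg (fibreW_nonneg Φ X) (pow_nonneg hL.le 3)),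
      ← ENNReal.ofReal_mul hw]
    congr 1
    rw [mul_pow, inv_pow, Real.sq_sqrt (pow_nonneg hL.le 3), div_pow]
    have hL3 : (L ^ 3 : ℝ) ≠ 0 := by positivity
    field_simp

/-- Measurability of the bath functions `X ↦ W(X̂) |ĉ_q(ψ(·|X̂))|²`. [folklore] -/
theorem ps_measurable_fibreW_mul_norm_sq (hL : 0 < L) (Φ : PeriodicTrialState (m + 1) L)
    (hΦ : ∀ X, Φ.ψ X ≠ 0) (q : Fin 3 → ℤ) :
    Measurable fun X : Config (m + 1) => ENNReal.ofReal (fibreW Φ X *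
      ‖cellFourierCoeff L (fun y => (fibrePsi Φ (Function.update X 0 y) : ℂ)) q‖ ^ 2) :=
  ((measurable_fibreW Φ).mul
    ((continuous_cellFourierCoeff_fibrePsi hL Φ hΦ q).measurable.norm.pow_const 2)).ennreal_ofReal

/-- **The bath-averaged flat corrector energy is an occupation sum**:
`∫_{cell^N} W·flatEnergy dX = Σ_{p≠0} w_p · n_{p−n}(|Φ|)/N`, `w_p = (n·(p−n))²/(|n|⁴|k_p|²)`
(Tonelli, and `∫ W|ĉ_q(ψ)|² = n_q(|Φ|)/N`). [folklore] -/
theorem ps_lintegral_fibreW_mul_flatEnergy_eq (hL : 0 < L) {n : Fin 3 → ℤ} (hn : n ≠ 0)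
    (Φ : PeriodicTrialState (m + 1) L) (hΦ : ∀ X, Φ.ψ X ≠ 0) :
    ∫⁻ X in cellN (m + 1) L, ENNReal.ofReal (fibreW Φ X) * flatEnergy n Φ X =
      ∑' p : Fin 3 → ℤ, if p = 0 then 0 else
        ENNReal.ofReal ((∑ l, (n l : ℝ) * ((p l : ℝ) - n l)) ^ 2 /
            ((∑ l, (n l : ℝ) ^ 2) ^ 2 * ((2 * Real.pi / L) ^ 2 * ∑ j, (p j : ℝ) ^ 2))) *
          (cellOccupation (m + 1) L (planeWaveMode L (p - n)) (fun X => (‖Φ.ψ X‖ : ℂ)) /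
            (m + 1 : ℝ≥0∞)) := by
  simp_rw [ps_fibreW_mul_flatEnergy hL hn Φ hΦ]
  rw [lintegral_tsum fun p => ?_]
  · refine tsum_congr fun p => ?_
    by_cases hp : p = 0
    · simp [hp]
    · simp only [hp, ↓reduceIte]
      rw [lintegral_const_mul _ (ps_measurable_fibreW_mul_norm_sq hL Φ hΦ _),
        lintegral_fibreW_mul_norm_sq_cellFourierCoeff hL Φ hΦ]
  · by_cases hp : p = 0
    · simp only [hp, ↓reduceIte]
      exact aemeasurable_const
    · simp only [hp, ↓reduceIte]
      exact ((ps_measurable_fibreW_mul_norm_sq hL Φ hΦ _).const_mul _).aemeasurable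

/-! ### The lattice count -/

/-- **Lattice count**: `Σ_{p ∈ ℤ³, 0 < ‖p‖_∞ ≤ R} ‖p‖_∞⁻² ≤ 26R` (shell by shell: the shell
`‖p‖_∞ = j` has `(2j+1)³ − (2j−1)³ = 24j² + 2 ≤ 26j²` points, each weighing `j⁻²`). [folklore] -/
theorem ps_lattice_count (R : ℕ) :
    ∑ p ∈ (Fintype.piFinset fun _ : Fin 3 => Finset.Icc (-(R : ℤ)) R).erase 0,
        1 / ‖(fun j => (p j : ℝ))‖ ^ 2 ≤ 26 * (R : ℝ) := by
  -- the boxes `{‖p‖_∞ ≤ R}`: cardinality `(2R+1)³`, monotone in `R`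
  have hcard : ∀ R : ℕ,
      ((Fintype.piFinset fun _ : Fin 3 => Finset.Icc (-(R : ℤ)) R).card : ℝ) = (2 * R + 1) ^ 3 := by
    intro R
    rw [Fintype.card_piFinset, Finset.prod_const, Finset.card_univ, Fintype.card_fin, Int.card_Icc,
      show ((R : ℤ) + 1 - -(R : ℤ)) = ((2 * R + 1 : ℕ) : ℤ) by push_cast; ring, Int.toNat_natCast]
    push_cast
    ring
  have hmono : ∀ R : ℕ, (Fintype.piFinset fun _ : Fin 3 => Finset.Icc (-(R : ℤ)) R) ⊆
      Fintype.piFinset fun _ : Fin 3 => Finset.Icc (-((R + 1 : ℕ) : ℤ)) (R + 1 : ℕ) := by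
    intro R p hp
    rw [Fintype.mem_piFinset] at hp ⊢
    intro i
    have := Finset.mem_Icc.1 (hp i)
    exact Finset.mem_Icc.2 ⟨by push_cast; omega, by push_cast; omega⟩
  induction R with
  | zero =>
    have h0 : (Fintype.piFinset fun _ : Fin 3 => Finset.Icc (-((0 : ℕ) : ℤ)) (0 : ℕ)) = {0} := by
      ext p
      simp only [Fintype.mem_piFinset, Nat.cast_zero, neg_zero, Finset.Icc_self,
        Finset.mem_singleton, funext_iff, Pi.zero_apply]
    rw [h0]
    simp
  | succ R ih =>
    set B₀ := Fintype.piFinset fun _ : Fin 3 => Finset.Icc (-(R : ℤ)) R with hB₀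
    set B₁ := Fintype.piFinset fun _ : Fin 3 => Finset.Icc (-((R + 1 : ℕ) : ℤ)) (R + 1 : ℕ)
      with hB₁
    have hsub : B₀ ⊆ B₁ := hmono R
    have hsplit : B₁.erase 0 ⊆ B₀.erase 0 ∪ (B₁ \ B₀) := by
      intro p hp
      rw [Finset.mem_erase] at hp
      by_cases h : p ∈ B₀
      · exact Finset.mem_union_left _ (Finset.mem_erase.2 ⟨hp.1, h⟩)
      · exact Finset.mem_union_right _ (Finset.mem_sdiff.2 ⟨hp.2, h⟩)
    have hdisj : Disjoint (B₀.erase 0) (B₁ \ B₀) :=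
      Finset.disjoint_sdiff.mono_left (Finset.erase_subset _ _)
    have hshell : ∀ p ∈ B₁ \ B₀, 1 / ‖(fun j => (p j : ℝ))‖ ^ 2 ≤ 1 / ((R : ℝ) + 1) ^ 2 := by
      intro p hp
      rw [Finset.mem_sdiff] at hp
      obtain ⟨i, hi⟩ : ∃ i, p i ∉ Finset.Icc (-(R : ℤ)) R := by
        by_contra h
        push Not at h
        exact hp.2 (Fintype.mem_piFinset.2 h)
      rw [Finset.mem_Icc, not_and_or, not_le, not_le] at hi
      have hZ : (R : ℤ) + 1 ≤ |p i| := by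
        rcases hi with hi | hi
        · exact le_abs.2 (Or.inr (by omega))
        · exact le_abs.2 (Or.inl (by omega))
      have hRi : (R : ℝ) + 1 ≤ |(p i : ℝ)| := by exact_mod_cast hZ
      have hnorm : (R : ℝ) + 1 ≤ ‖(fun j => (p j : ℝ))‖ :=
        hRi.trans ((Real.norm_eq_abs _).symm.le.trans (norm_le_pi_norm (fun j => (p j : ℝ)) i))
      exact one_div_le_one_div_of_le (by positivity) (pow_le_pow_left₀ (by positivity) hnorm 2)
    have hcardshell : ((B₁ \ B₀).card : ℝ) ≤ 26 * ((R : ℝ) + 1) ^ 2 := by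
      have h := Finset.card_sdiff_add_card_eq_card hsub
      have h' : ((B₁ \ B₀).card : ℝ) + (2 * (R : ℕ) + 1 : ℝ) ^ 3 =
          (2 * ((R + 1 : ℕ) : ℝ) + 1) ^ 3 := by
        rw [← hcard R, ← hcard (R + 1)]
        exact_mod_cast h
      push_cast at h'
      nlinarith [h', sq_nonneg (R : ℝ), (Nat.cast_nonneg R : (0 : ℝ) ≤ R)]
    have hR1 : (R : ℝ) + 1 ≠ 0 := by positivity
    calc ∑ p ∈ B₁.erase 0, 1 / ‖(fun j => (p j : ℝ))‖ ^ 2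
        ≤ ∑ p ∈ B₀.erase 0 ∪ (B₁ \ B₀), 1 / ‖(fun j => (p j : ℝ))‖ ^ 2 :=
          Finset.sum_le_sum_of_subset_of_nonneg hsplit fun _ _ _ => by positivity
      _ = ∑ p ∈ B₀.erase 0, 1 / ‖(fun j => (p j : ℝ))‖ ^ 2 +
            ∑ p ∈ B₁ \ B₀, 1 / ‖(fun j => (p j : ℝ))‖ ^ 2 := Finset.sum_union hdisj
      _ ≤ 26 * R + ∑ p ∈ B₁ \ B₀, 1 / ((R : ℝ) + 1) ^ 2 := add_le_add ih (Finset.sum_le_sum hshell)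
      _ = 26 * R + (B₁ \ B₀).card * (1 / ((R : ℝ) + 1) ^ 2) := by
          rw [Finset.sum_const, nsmul_eq_mul]
      _ ≤ 26 * R + 26 * ((R : ℝ) + 1) ^ 2 * (1 / ((R : ℝ) + 1) ^ 2) := by gcongr
      _ = 26 * ((R + 1 : ℕ) : ℝ) := by
          push_cast
          field_simp

end Summit.AtomisticToContinuum.BoseEinsteinCondensation.Cruxes.FibreConductance.ParsevalShellBootstrap

end
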